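import Summits.Langlands.Langlands.Theses.ParityBlindBianchi
import Summits.Langlands.Langlands.Theorems.ParityBlindBianchiResidualBianchiDoorLevel
import Summits.Langlands.Langlands.Theorems.ParityBlindBianchiIcosahedralDescentLevelMain
import HarnessLib

/-!
# Line `DoorFromOwnChain` for crux stmt-Langlands-15113 `IcosahedralDescentLevel`, sharpened: the chain
# consumes the route's thesis X = E2′ ∧ R′ at ONE instance only — and that instance suffices

Lead prover a1, `--supports stmt-Langlands-15113` (registered transfer stub `stub_artinOfBianchiArtin` of
the skeleton `Cruxes/IcosahedralDescentLevel/Lines/DoorFromOwnChain.lean`, v3).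

`Theorems/ParityBlindBianchiIcosahedralDescentLevelOfThesis.lean` (p121025) derived the TYPED crux (≡ all-parity
icosahedral strong Artin over `ℚ`) from the seven printed named facts and the two open cruxes E2′
`TwoAdicBianchiProModularityLevel` (stmt-Langlands-15110) and R′ `ArtinWeightRealisationLevel`
(stmt-Langlands-15111) taken whole.  Reading that proof shows the two cruxes are consumed only JOINTLY
(the 2-adic Hecke point produced by E2′ is fed to R′ and to nothing else) and only at ONE instance:
`p = 2`, `σ = σ₀|_{Γ_K}` the restriction to `Γ_K` of a 2-adic representation `σ₀` of `Γ_ℚ` (so `σ ≅ σ^c`),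
and a bad set `S ∋ 2` consisting of PRIMES.  This file isolates that instance as one proposition — the
hypothesis `hX` below, verbatim the registered stub `stub_bianchiArtin` — and proves:

* `artinAE_of_bianchiArtin` — seven facts + `hX` ⊢ a.e. strong Artin for EVERY irreducible icosahedral
  `ρ/ℚ` (same proof as `artinAE_of_thesis`, the E2′/R′ step replaced by one call to `hX`);
* `stub_artinOfBianchiArtin` — the registered transfer stub: seven facts → `hX` → a.e. strong Artin for
  every irreducible icosahedral `ρ/ℚ` (curried `artinAE_of_bianchiArtin`);
* `bianchiArtin_of_thesis` — E2′ → R′ → `hX` (three lines): the v3 crux stub follows from the items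
  stmt-Langlands-15110 ∧ stmt-Langlands-15111 the moment they land, and is a priori WEAKER than either
  (no Hecke point is asserted; only restrictions from `ℚ`; only `p = 2`; only prime-only `S`).

For the tenure planner this is the thinnest honest shape of the route over `K`: ONE crux (`hX`) plus print.
Honest label: wiring; `proof.conditional` on exactly the seven Literature facts.
-/

-- `Summit.Langlands.Langlands.…`: the repeated path component is the tree's layout (D-0017).
set_option linter.dupNamespace false

noncomputable section

open scoped MatrixGroups NumberField Polynomial Classical
open NumberField IsDedekindDomain Field Filter
open Literature.NumberTheory.Automorphic Literature.NumberTheory.GaloisRepresentations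
open Summit.Langlands.Langlands.Theses.ParityBlindBianchi
open Summit.Langlands.Langlands.Cruxes.ResidualBianchiDoorLevel.Sketch
  (stub_qLevel stub_cuspWitness stub_bcTransfer framedGaloisRep_eq_of_toMonoidHom_eq)

namespace Summit.Langlands.Langlands.Theorems.IcosahedralDescentLevel

/-- **Seven facts + the thesis at the consumed instance ⊢ a.e. strong Artin for every irreducible
icosahedral `ρ/ℚ`.**  `hX` is verbatim the skeleton's crux stub `stub_bianchiArtin`: for 2-split imaginary
quadratic `K`, restrictions `σ₀|_{Γ_K}` (finite image, irreducible, projectively `A₅`) with a regular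
algebraic cuspidal residual rung off a prime-only `S ∋ 2` are Satake–Frobenius compatible with a cuspidal
`π_K` at every place off `S`.  Proof: `stub_qLevel` (E1′ over `ℚ`), per `K` `exists_padicModel_restrictField`
+ `stub_cuspWitness` + `stub_bcTransfer`, then `hX`, then `icosahedralDescentLevel_repaired` (D″, p111861;
`0 ∉ S` by primality). [folklore] -/
theorem artinAE_of_bianchiArtin
    (hKW : ∀ (p : ℕ) [Fact p.Prime] (k : Type) [Field k] [TopologicalSpace k] [DiscreteTopology k],
      khare_wintenberger p k)
    (hBC : baseChange_cyclic_cuspidal) (hArch : ArthurClozel1989_strongLifting_archimedean)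
    (hR1 : ArthurClozel1989_strongLifting_allFinite) (hdesc : cuspidal_descent_cyclic)
    (hSL : ArthurClozel1989_strongLifting_unramified) (hfib : ArthurClozel_fibres_quadratic)
    (hX : ∀ (K : Type) [Field K] [NumberField K], NumberField.IsTotallyComplex K → Module.finrank ℚ K = 2 →
      (∃ v w : HeightOneSpectrum (𝓞 K), v ≠ w ∧ ((2 : ℕ) : 𝓞 K) ∈ v.asIdeal ∧ ((2 : ℕ) : 𝓞 K) ∈ w.asIdeal) →
      ∀ (ι : PadicAlgCl 2 ≃+* ℂ) (σ₀ : FramedGaloisRep ℚ (PadicAlgCl 2) 2),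
        Finite (σ₀.restrictField K).toMonoidHom.range →
        (σ₀.restrictField K).toGaloisRep.IsIrreducible →
        Nonempty ((Matrix.ProjGenLinGroup.mk.comp (σ₀.restrictField K).toMonoidHom).range ≃*
          alternatingGroup (Fin 5)) →
        ∀ S : Finset ℕ, 2 ∈ S → (∀ ℓ ∈ S, ℓ.Prime) →
          (∃ (hcpt : isCompact_glFiniteIntegralLevel 2 K) (π₀ : CuspidalAutomorphicRepData 2 K hcpt),
              π₀.1.IsRegularAlgebraic ∧
                ∀ v : HeightOneSpectrum (𝓞 K), (∀ ℓ ∈ S, ((ℓ : ℕ) : 𝓞 K) ∉ v.asIdeal) →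
                  ∃ (α : Multiset ℂ) (P : Polynomial (PadicAlgCl 2)), π₀.1.HasSatakeParamAt v α ∧
                    (σ₀.restrictField K).IsUnramifiedAt v ∧ (σ₀.restrictField K).HasFrobCharpolyAt v P ∧
                      ∀ i : ℕ, ‖P.coeff i - (arithFrobPolyOfSatake ι v.residueCard 2 α).coeff i‖ < 1) →
          ∃ (hcpt : isCompact_glFiniteIntegralLevel 2 K) (π : CuspidalAutomorphicRepData 2 K hcpt),
            ∀ w : HeightOneSpectrum (𝓞 K), (∀ ℓ ∈ S, ((ℓ : ℕ) : 𝓞 K) ∉ w.asIdeal) →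
              Summit.Langlands.SatakeFrobCompatibleAt ι π.1 (σ₀.restrictField K) w)
    (ι : PadicAlgCl 2 ≃+* ℂ) (ρ : FramedGaloisRep ℚ ℂ 2) (hirr : ρ.toGaloisRep.IsIrreducible)
    (hA5 : Nonempty ((Matrix.ProjGenLinGroup.mk.comp ρ.toMonoidHom).range ≃*
      alternatingGroup (Fin 5))) :
    ∃ (hcpt : isCompact_glFiniteIntegralLevel 2 ℚ) (π : CuspidalAutomorphicRepData 2 ℚ hcpt),
      ∀ᶠ v : HeightOneSpectrum (𝓞 ℚ) in cofinite, ∃ α : Multiset ℂ,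
        π.1.HasSatakeParamAt v α ∧ ρ.IsUnramifiedAt v ∧
          ρ.HasFrobCharpolyAt v (satakePolynomial α) := by
  -- E1′ over `ℚ`, with a PRIME-ONLY bad set `S ∋ 2`
  obtain ⟨S, h2S, hS, σ₀, hσ₀, hcptQ, πQ, hRA, hgood⟩ := stub_qLevel hKW ι ρ hirr hA5
  have h0 : (0 : ℕ) ∉ S := fun h => Nat.not_prime_zero (hS 0 h)
  -- the repaired uniform descent D″ reduces the claim to the uniform family off `S`
  refine icosahedralDescentLevel_repaired hdesc hSL hBC hfib ι ρ S h0 ?_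
  intro K _ _ htc hdeg hsplit
  -- the Galois side over `K`: the same `σ₀`, restricted to `Γ_K`
  obtain ⟨σ₀', hσ₀', hfin, hproj, hmodel, hfinK, hirrK, hA5K⟩ :=
    Summit.Langlands.Langlands.Theorems.ResidualBianchiDoorMod2.exists_padicModel_restrictField
      ι ρ hA5 K hdeg
  obtain rfl : σ₀' = σ₀ := framedGaloisRep_eq_of_toMonoidHom_eq (hσ₀'.trans hσ₀.symm)
  -- the residual rung over `K` at every place off `S`
  obtain ⟨hcpt, π₀, hRA₀, hgood₀⟩ := stub_bcTransfer hBC hArch hR1 ι σ₀' S hcptQ πQ hRA hgood K hdeg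
    (stub_cuspWitness ι σ₀' hfin hproj S hS hcptQ πQ hgood K hdeg)
  -- the thesis at the consumed instance
  obtain ⟨hcpt', π, hπ⟩ := hX K htc hdeg hsplit ι σ₀' hfinK hirrK hA5K S h2S hS ⟨hcpt, π₀, hRA₀, hgood₀⟩
  exact ⟨σ₀'.restrictField K, hcpt', π, hmodel, hπ⟩

/-- **Registered transfer stub of the line's skeleton (v3)**, verbatim signature: the seven printed named
facts and the crux stub `stub_bianchiArtin` imply a.e. strong Artin for every irreducible icosahedral `ρ/ℚ`
(`artinAE_of_bianchiArtin`, curried; the typed crux is this with its hypothesis dropped). [folklore] -/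
theorem stub_artinOfBianchiArtin :
    (∀ (p : ℕ) [Fact p.Prime] (k : Type) [Field k] [TopologicalSpace k] [DiscreteTopology k],
      khare_wintenberger p k) →
    baseChange_cyclic_cuspidal → ArthurClozel1989_strongLifting_archimedean →
    ArthurClozel1989_strongLifting_allFinite → cuspidal_descent_cyclic →
    ArthurClozel1989_strongLifting_unramified → ArthurClozel_fibres_quadratic →
    (∀ (K : Type) [Field K] [NumberField K], NumberField.IsTotallyComplex K → Module.finrank ℚ K = 2 →
      (∃ v w : HeightOneSpectrum (𝓞 K), v ≠ w ∧ ((2 : ℕ) : 𝓞 K) ∈ v.asIdeal ∧ ((2 : ℕ) : 𝓞 K) ∈ w.asIdeal) →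
      ∀ (ι : PadicAlgCl 2 ≃+* ℂ) (σ₀ : FramedGaloisRep ℚ (PadicAlgCl 2) 2),
        Finite (σ₀.restrictField K).toMonoidHom.range →
        (σ₀.restrictField K).toGaloisRep.IsIrreducible →
        Nonempty ((Matrix.ProjGenLinGroup.mk.comp (σ₀.restrictField K).toMonoidHom).range ≃*
          alternatingGroup (Fin 5)) →
        ∀ S : Finset ℕ, 2 ∈ S → (∀ ℓ ∈ S, ℓ.Prime) →
          (∃ (hcpt : isCompact_glFiniteIntegralLevel 2 K) (π₀ : CuspidalAutomorphicRepData 2 K hcpt),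
              π₀.1.IsRegularAlgebraic ∧
                ∀ v : HeightOneSpectrum (𝓞 K), (∀ ℓ ∈ S, ((ℓ : ℕ) : 𝓞 K) ∉ v.asIdeal) →
                  ∃ (α : Multiset ℂ) (P : Polynomial (PadicAlgCl 2)), π₀.1.HasSatakeParamAt v α ∧
                    (σ₀.restrictField K).IsUnramifiedAt v ∧ (σ₀.restrictField K).HasFrobCharpolyAt v P ∧
                      ∀ i : ℕ, ‖P.coeff i - (arithFrobPolyOfSatake ι v.residueCard 2 α).coeff i‖ < 1) →
          ∃ (hcpt : isCompact_glFiniteIntegralLevel 2 K) (π : CuspidalAutomorphicRepData 2 K hcpt),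
            ∀ w : HeightOneSpectrum (𝓞 K), (∀ ℓ ∈ S, ((ℓ : ℕ) : 𝓞 K) ∉ w.asIdeal) →
              Summit.Langlands.SatakeFrobCompatibleAt ι π.1 (σ₀.restrictField K) w) →
    ∀ (ι : PadicAlgCl 2 ≃+* ℂ) (ρ : FramedGaloisRep ℚ ℂ 2), ρ.toGaloisRep.IsIrreducible →
      Nonempty ((Matrix.ProjGenLinGroup.mk.comp ρ.toMonoidHom).range ≃* alternatingGroup (Fin 5)) →
      ∃ (hcpt : isCompact_glFiniteIntegralLevel 2 ℚ) (π : CuspidalAutomorphicRepData 2 ℚ hcpt),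
        ∀ᶠ v : HeightOneSpectrum (𝓞 ℚ) in cofinite, ∃ α : Multiset ℂ,
          π.1.HasSatakeParamAt v α ∧ ρ.IsUnramifiedAt v ∧ ρ.HasFrobCharpolyAt v (satakePolynomial α) :=
  fun hKW hBC hArch hR1 hdesc hSL hfib hX ι ρ hirr hA5 =>
    artinAE_of_bianchiArtin hKW hBC hArch hR1 hdesc hSL hfib hX ι ρ hirr hA5

/-- **The v3 crux stub follows from the route's two open cruxes** E2′ `TwoAdicBianchiProModularityLevel`
(stmt-Langlands-15110) and R′ `ArtinWeightRealisationLevel` (stmt-Langlands-15111): instantiate E2′ at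
`σ₀|_{Γ_K}` and feed its 2-adic Hecke point to R′ at `p = 2`.  The primality of `S` is not even used. [folklore] -/
theorem bianchiArtin_of_thesis (hE2 : TwoAdicBianchiProModularityLevel) (hR : ArtinWeightRealisationLevel) :
    ∀ (K : Type) [Field K] [NumberField K], NumberField.IsTotallyComplex K → Module.finrank ℚ K = 2 →
      (∃ v w : HeightOneSpectrum (𝓞 K), v ≠ w ∧ ((2 : ℕ) : 𝓞 K) ∈ v.asIdeal ∧ ((2 : ℕ) : 𝓞 K) ∈ w.asIdeal) →
      ∀ (ι : PadicAlgCl 2 ≃+* ℂ) (σ₀ : FramedGaloisRep ℚ (PadicAlgCl 2) 2),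
        Finite (σ₀.restrictField K).toMonoidHom.range →
        (σ₀.restrictField K).toGaloisRep.IsIrreducible →
        Nonempty ((Matrix.ProjGenLinGroup.mk.comp (σ₀.restrictField K).toMonoidHom).range ≃*
          alternatingGroup (Fin 5)) →
        ∀ S : Finset ℕ, 2 ∈ S → (∀ ℓ ∈ S, ℓ.Prime) →
          (∃ (hcpt : isCompact_glFiniteIntegralLevel 2 K) (π₀ : CuspidalAutomorphicRepData 2 K hcpt),
              π₀.1.IsRegularAlgebraic ∧
                ∀ v : HeightOneSpectrum (𝓞 K), (∀ ℓ ∈ S, ((ℓ : ℕ) : 𝓞 K) ∉ v.asIdeal) →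
                  ∃ (α : Multiset ℂ) (P : Polynomial (PadicAlgCl 2)), π₀.1.HasSatakeParamAt v α ∧
                    (σ₀.restrictField K).IsUnramifiedAt v ∧ (σ₀.restrictField K).HasFrobCharpolyAt v P ∧
                      ∀ i : ℕ, ‖P.coeff i - (arithFrobPolyOfSatake ι v.residueCard 2 α).coeff i‖ < 1) →
          ∃ (hcpt : isCompact_glFiniteIntegralLevel 2 K) (π : CuspidalAutomorphicRepData 2 K hcpt),
            ∀ w : HeightOneSpectrum (𝓞 K), (∀ ℓ ∈ S, ((ℓ : ℕ) : 𝓞 K) ∉ w.asIdeal) →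
              Summit.Langlands.SatakeFrobCompatibleAt ι π.1 (σ₀.restrictField K) w :=
  fun K _ _ htc hdeg hsplit ι σ₀ hfinK hirrK hA5K S h2S _ hres =>
    hR K htc hdeg 2 ι (σ₀.restrictField K) hfinK hirrK S h2S
      (hE2 K htc hdeg hsplit ι (σ₀.restrictField K) hfinK hirrK hA5K S h2S hres)

end Summit.Langlands.Langlands.Theorems.IcosahedralDescentLevel

end
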